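import Literature.Computability.AlgebraicComplexity.DDS21TopFaninTwoTraceBack
import Literature.Computability.AlgebraicComplexity.DDS21TopFaninTwoDiDIL
import Literature.Computability.AlgebraicComplexity.DDS21DeborderReadOnce
import Literature.AlgebraicGeometry.Hironaka2017.RationalApex
import Mathlib.Algebra.MvPolynomial.Equiv
import Mathlib.Data.Finsupp.Fin
import HarnessLib

/-!
# Dutta–Dwivedi–Saxena 2021, Thm. 3.2 at `k = 2`: `\overline{Σ^{[2]}Π^{[d]}Σ} ⊆ ABP` (assembly)

Topic `Literature/Computability/AlgebraicComplexity`; cell `val-lit`, row X2-DDS21 (lead-np RULINGS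
(132)(c)/(133)); a PROOFS file: theorems only, no definitions, no named facts. Source: P. Dutta,
P. Dwivedi, N. Saxena, *Demystifying the border of depth-3 algebraic circuits*, FOCS 2021
[DuttaDwivediSaxena2022] (full version `paper:galaxy-pdf-7641649743695546420`), Thm. 3.2 ("`k = 2` is
already non-trivial", p0026 L717); the `k = 2` write-up of the survey [DuttaLysikov2025] §4.4.1.

## What is proved

`DDS2021_thm_3_2_two`: there is an absolute constant `c` such that for every field `F` of
characteristic `0`, all `n, d ≤ s`, `2 ≤ s`, and every `f ∈ F[x_1,…,x_n]` in the border of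
`Σ^{[2]}Π^{[d]}Σ` over `F(ε)`, a univariate-labelled layered ABP within budget `s ^ c` computes `f` —
the `k = 2` instance of the named fact `DDS2021_thm_3_2` (`DDS21BorderDepthThree.lean`), which itself
(all `k`) stays OPEN by name. Assembly of three landed pieces: the `ε`-side
`border_spsClass_two_dlog_identity` (t19 g11, `DDS21TopFaninTwoDiDIL.lean`: either `f ∈ Σ^{[2]}ΠΣ`
exactly, or the Wronskian/`dlog` identity `c·(Φf'·ΦT₁ − Φf·ΦT₁') ≡ ΦT₀·ΦT₁·Σ_{r<N} q_r z^r
(mod z^N)` in `F[x][z]` with `q_r ∈ \overline{Σ∧Σ}`), the frame bridge `finSuccEquiv` to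
`F[x_0, …, x_n]` (`z = x_0`), `\overline{Σ∧Σ} ⊆ ABP` (t24, `uabpComputes_of_mem_border_swsClass_le`),
and the trace-back `uabpComputes_of_wronskian_congr` (p2 g10, `DDS21TopFaninTwoTraceBack.lean`, on
t18 g10's `truncDegreeOf` calculus and final step).

Honest framing: a published 2021 upper bound for top fan-in `2`; nothing here bears on VP versus VNP,
which is NOT proved.

## References

* [DuttaDwivediSaxena2022] P. Dutta, P. Dwivedi, N. Saxena, *Demystifying the border of depth-3
  algebraic circuits*, Proc. 62nd FOCS (2021), IEEE 2022, 92–103; full version: Thm. 3.2 p0026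
  L710–717 and its proof §3.1 p0028–p0036.
* [DuttaLysikov2025] P. Dutta, V. Lysikov, *Recent advances in debordering methods*, arXiv:2510.13049,
  §4.4.1.
-/

noncomputable section

open MvPolynomial Literature.RingTheory.MvPolynomial Literature.AlgebraicGeometry.Hironaka2017
open scoped BigOperators Polynomial

namespace Literature.Computability.AlgebraicComplexity

namespace DDS2021

section Bridge

variable {F : Type*} [Field F] {n : ℕ}

/-- `finSuccEquiv` turns `∂/∂x_0` into `d/dz` (the tree's
`GurvitsCapacityBound.finSuccEquiv_pderiv_zero`, re-proved here to keep the import cone small).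
[cite: DuttaDwivediSaxena2022, §3.1 proof of Thm. 3.2 (full version p0028 L755–757)] -/
private theorem finSuccEquiv_pderiv_zero' (f : MvPolynomial (Fin (n + 1)) F) :
    finSuccEquiv F n (pderiv 0 f) = Polynomial.derivative (finSuccEquiv F n f) := by
  -- adapted from Literature/Combinatorics/StablePolynomials/GurvitsCapacityBound.lean
  induction f using MvPolynomial.induction_on with
  | C a => simp [finSuccEquiv_apply]
  | add p q hp hq => simp [hp, hq]
  | mul_X p i hp =>
    rw [pderiv_mul, map_add, map_mul, map_mul, hp, map_mul, Polynomial.derivative_mul]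
    refine Fin.cases ?_ (fun j => ?_) i
    · simp [finSuccEquiv_X_zero]
    · simp [finSuccEquiv_X_succ, pderiv_X_of_ne (Fin.succ_ne_zero j)]

/-- **Frame bridge**: congruence modulo `x_0^N` in `F[x_0,…,x_n]` is agreement of the `z^r`
coefficients, `r < N`, of the images in `F[x][z]` under `finSuccEquiv` (public twin:
`DDS2021.truncDegreeOf_zero_eq_iff` of `DDS21TopFaninTwoDiDIL.lean` v2, t19 g11, landed while this
file was written; private copy to stay independent of that build).
[cite: DuttaDwivediSaxena2022, §3.1 proof of Thm. 3.2 (full version p0028 L755, p0029 L779–782)] -/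
private theorem truncDegreeOf_zero_eq_iff_coeff {N : ℕ} (p q : MvPolynomial (Fin (n + 1)) F) :
    truncDegreeOf 0 N p = truncDegreeOf 0 N q ↔
      ∀ r < N, (finSuccEquiv F n p).coeff r = (finSuccEquiv F n q).coeff r := by
  rw [truncDegreeOf_eq_iff]
  constructor
  · intro h r hr
    ext m
    rw [finSuccEquiv_coeff_coeff, finSuccEquiv_coeff_coeff]
    exact h _ (by rwa [Finsupp.cons_zero])
  · intro h dd hdd
    have h1 := congrArg (coeff (Finsupp.tail dd)) (h (dd 0) hdd)
    rwa [finSuccEquiv_coeff_coeff, finSuccEquiv_coeff_coeff, Finsupp.cons_tail] at h1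

end Bridge

section Arith

/-- `a + b ≤ s^{i+1}` from `a, b ≤ s^i` (`s ≥ 2`). [folklore] -/
private theorem qadd {s i a b : ℕ} (hs : 2 ≤ s) (ha : a ≤ s ^ i) (hb : b ≤ s ^ i) :
    a + b ≤ s ^ (i + 1) := by
  rw [pow_succ]; nlinarith

/-- `a * b ≤ s^{i+j}` from `a ≤ s^i`, `b ≤ s^j`. [folklore] -/
private theorem qmul {s i j a b : ℕ} (ha : a ≤ s ^ i) (hb : b ≤ s ^ j) : a * b ≤ s ^ (i + j) := by
  rw [pow_add]; exact Nat.mul_le_mul ha hb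

/-- `s^i ≤ s^j` for `i ≤ j`, `s ≥ 2`. [folklore] -/
private theorem qmono {s i j a : ℕ} (hs : 2 ≤ s) (hij : i ≤ j) (ha : a ≤ s ^ i) : a ≤ s ^ j :=
  ha.trans (Nat.pow_le_pow_right (by omega) hij)

/-- `2 ≤ s^1`, `4 ≤ s^2` etc.: `2^t ≤ s^t`. [folklore] -/
private theorem qconst {s t a : ℕ} (hs : 2 ≤ s) (ha : a ≤ 2 ^ t) : a ≤ s ^ t :=
  ha.trans (Nat.pow_le_pow_left hs t)

end Arith

section Main

variable {F : Type*} [Field F] {n : ℕ}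

/-- A border-`Σ^{[k]}Π^{[d]}Σ` polynomial has total degree `≤ d`: the approximating circuit over
`F(ε)` has degree `≤ d` and `ε`-approximation does not enlarge the support.
[cite: DuttaDwivediSaxena2022, Def. 2.1 and §1.1 (full version p0016 L416–419, p0006 L120–121)] -/
theorem totalDegree_le_of_mem_border_spsClass {k d : ℕ} {f : MvPolynomial (Fin n) F}
    (hf : f ∈ border (spsClass (RatFunc F) n k d)) : f.totalDegree ≤ d := by
  obtain ⟨g, hg, hle, happ⟩ := hf
  have hid : rename (Fin.castLE hle) f = f := by
    rw [show (Fin.castLE hle : Fin n → Fin n) = id from funext fun i => Fin.ext rfl]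
    exact rename_id_apply f
  have hgd : g.totalDegree ≤ d := totalDegree_le_of_mem_spsClass hg
  rw [MvPolynomial.totalDegree]
  refine Finset.sup_le fun e he => le_trans (le_totalDegree ?_) hgd
  obtain ⟨p, hpg, hp0⟩ := happ e
  rw [hid] at hp0
  rw [mem_support_iff, hpg]
  intro h0
  have hp : p = 0 := (map_eq_zero_iff _ (IsFractionRing.injective F[X] (RatFunc F))).1 h0
  exact (mem_support_iff.1 he) (by rw [← hp0, hp, Polynomial.coeff_zero])

variable [CharZero F]

/-- **DDS Thm. 3.2 at `k = 2`** (`\overline{Σ^{[2]}Π^{[d]}Σ} ⊆ ABP`, "`k = 2` is already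
non-trivial"): one absolute exponent `c` such that for all `n, d ≤ s`, `2 ≤ s` and every `f` in the
border of `Σ^{[2]}Π^{[d]}Σ` over `F(ε)` (`F` of characteristic `0`), `f` is computed by a
univariate-labelled layered ABP within budget `s ^ c` — the `k = 2` instance of the named fact
`DDS2021_thm_3_2`. Assembly: `border_spsClass_two_dlog_identity` (ε-side, t19 g11) with `N := d`,
the `finSuccEquiv` bridge, `\overline{Σ∧Σ} ⊆ ABP` for the `q_r`, and
`uabpComputes_of_wronskian_congr_pow` (trace-back, p2 g10, on t18 g10's calculus).
[cite: DuttaDwivediSaxena2022, Thm. 3.2 (full version p0026 L710–717) and its proof §3.1 (p0028–p0036)]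
[cite: DuttaLysikov2025, §4.4.1 "The k = 2 case" (arXiv:2510.13049 p0023–p0024)] -/
theorem DDS2021_thm_3_2_two : ∃ c : ℕ, ∀ (F : Type) [Field F] [CharZero F] (n d s : ℕ)
    (f : MvPolynomial (Fin n) F), d ≤ s → n ≤ s → 2 ≤ s →
      f ∈ border (spsClass (RatFunc F) n 2 d) → UABPComputes (s ^ c) f := by
  refine ⟨20 * 182, fun F _ _ n d s f hds hns hs hf => ?_⟩
  classical
  -- bookkeeping of powers of `s`
  have h1s : (1 : ℕ) ≤ s ^ 1 := Nat.one_le_pow _ _ (by omega)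
  have h2s : (2 : ℕ) ≤ s ^ 1 := by rw [pow_one]; exact hs
  have hd1 : d ≤ s ^ 1 := by rw [pow_one]; exact hds
  have hn1 : n ≤ s ^ 1 := by rw [pow_one]; exact hns
  have hn1' : n + 1 ≤ s ^ 2 := qadd hs hn1 h1s
  have hd1' : d + 1 ≤ s ^ 2 := qadd hs hd1 h1s
  have hd2 : d + 2 ≤ s ^ 2 := qadd hs hd1 h2s
  have hs2 : 2 ≤ s ^ 2 := qmono hs (by norm_num) h2s
  -- the `ΠΣ` budget `k * (2 + d * ((n + 1) * 2 + 2)) + 2`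
  have hPi : ∀ k : ℕ, k ≤ s ^ 1 → k * (2 + d * ((n + 1) * 2 + 2)) + 2 ≤ s ^ 8 := fun k hk =>
    qadd hs (qmul hk (qadd hs (qmono hs (by norm_num) h2s)
      (qmul hd1 (qadd hs (qmul hn1' h2s) (qmono hs (by norm_num) h2s)))))
      (qmono hs (by norm_num) h2s)
  have hfd : f.totalDegree ≤ d := totalDegree_le_of_mem_border_spsClass hf
  rcases border_spsClass_two_dlog_identity hf d with hsps | ⟨α, Φ, σ, A, T, c, q, hΦ, hT, hTα, hc, hq, hid⟩
  · -- degenerate limits: `f ∈ Σ^{[2]}ΠΣ` exactly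
    exact qmono hs (by norm_num) (hPi 2 h2s) |> (uabpComputes_of_mem_spsClass hsps).mono
  · -- the frame `z = x_0`
    set Φ18 : MvPolynomial (Fin n) F →ₐ[F] MvPolynomial (Fin (n + 1)) F :=
      aeval (fun i : Fin n => (X 0 * X i.succ + C (α i) : MvPolynomial (Fin (n + 1)) F)) with hΦ18
    have hE : ∀ p, finSuccEquiv F n (Φ18 p) = Φ p := fun p => by
      rw [hΦ18, finSuccEquiv_aeval_phi, hΦ]
    set R : MvPolynomial (Fin (n + 1)) F := C c⁻¹ * (Φ18 (T 0) * Φ18 (T 1) *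
      ∑ r ∈ Finset.range d, rename Fin.succ (q r) * X 0 ^ r) with hR
    -- (1) the Wronskian congruence in the `x_0` frame
    have hP : truncDegreeOf 0 d (pderiv 0 (Φ18 f) * Φ18 (T 1) - Φ18 f * pderiv 0 (Φ18 (T 1))) =
        truncDegreeOf 0 d R := by
      rw [truncDegreeOf_zero_eq_iff_coeff]
      intro r hr
      have hW : finSuccEquiv F n (pderiv 0 (Φ18 f) * Φ18 (T 1) - Φ18 f * pderiv 0 (Φ18 (T 1))) =
          Polynomial.derivative (Φ f) * Φ (T 1) - Φ f * Polynomial.derivative (Φ (T 1)) := by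
        rw [map_sub, map_mul, map_mul, finSuccEquiv_pderiv_zero', finSuccEquiv_pderiv_zero', hE, hE]
      have hER : finSuccEquiv F n R = Polynomial.C (C c⁻¹) *
          (Φ (T 0) * Φ (T 1) * ∑ r' ∈ Finset.range d, Polynomial.C (q r') * Polynomial.X ^ r') := by
        rw [hR, map_mul, RationalApex.finSuccEquiv_C', map_mul, map_mul, hE, hE, map_sum]
        congr 2
        refine Finset.sum_congr rfl fun r' _ => ?_
        rw [map_mul, map_pow, RationalApex.finSuccEquiv_rename_succ, finSuccEquiv_X_zero]
      have h := hid r hr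
      rw [Polynomial.coeff_C_mul] at h
      rw [hW, hER, Polynomial.coeff_C_mul, ← h, ← mul_assoc, ← C_mul, inv_mul_cancel₀ hc, C_1, one_mul]
    -- (2) ABPs: `T i`, `Φ18 (T i)`, the `q_r`, `R`
    have hmem : ∀ i, (∏ j, (C (A i j none) + ∑ m, C (A i j (some m)) * X m) :
        MvPolynomial (Fin n) F) ∈ spsClass F n 1 d := fun i =>
      ⟨fun _ => A i, by simp only [Fin.sum_univ_one]⟩
    have hTabp : ∀ i, UABPComputes (1 * (2 + d * ((n + 1) * 2 + 2)) + 2 + 2) (T i) := fun i => by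
      rw [hT i]
      exact (uabpComputes_of_mem_spsClass (hmem i)).smul_C (σ i)
    have hTdeg : ∀ i, (T i).totalDegree ≤ d := fun i => by
      rw [hT i]
      refine (totalDegree_mul _ _).trans ?_
      rw [totalDegree_C, zero_add]
      exact totalDegree_le_of_mem_spsClass (hmem i)
    have hST : 1 * (2 + d * ((n + 1) * 2 + 2)) + 2 + 2 ≤ s ^ 9 :=
      qadd hs (hPi 1 h1s) (qmono hs (by norm_num) h2s)
    have hWabp : ∀ i, UABPComputes (s ^ 15) (Φ18 (T i)) := fun i =>
      ((hTabp i).aeval_phi (hTdeg i) α).mono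
        (qadd hs (qmul hd1' (qadd hs (qmono hs (by norm_num) hd2) (qmul hST hd1')))
          (qmono hs (by norm_num) h2s))
    have h2d : 2 * d ≤ s ^ 2 := qmul h2s hd1
    have hqabp : ∀ r' : Fin d, UABPComputes (s ^ 15)
        (rename Fin.succ (q r') * X 0 ^ (r' : ℕ) : MvPolynomial (Fin (n + 1)) F) := fun r' => by
      have hq' := (uabpComputes_of_mem_border_swsClass_le (hq r' r'.isLt) h2d
        (qmono hs (by norm_num) (show (r' : ℕ) + 1 ≤ s ^ 1 from (Nat.succ_le_of_lt r'.isLt).trans hd1))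
        (qmono hs (by norm_num) hn1) hs2).rename Fin.succ
      rw [← pow_mul] at hq'
      have hX : UABPComputes (s ^ 2) (X 0 ^ (r' : ℕ) : MvPolynomial (Fin (n + 1)) F) := by
        refine (UABPComputesLen.of_label hs2 _ ?_ ?_).uabpComputes
        · refine (Finset.card_le_card (vars_pow _ _)).trans ?_
          rw [vars_X, Finset.card_singleton]
        · refine (totalDegree_pow _ _).trans ?_
          rw [totalDegree_X, mul_one]
          exact qmono hs (by norm_num) ((le_of_lt r'.isLt).trans hd1)
      exact (hq'.mul hX).mono (qadd hs le_rfl (Nat.pow_le_pow_right (by omega) (by norm_num)))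
    have h1515 : s ^ 15 + s ^ 15 ≤ s ^ 16 := qadd hs le_rfl le_rfl
    have hsum : UABPComputes (d * (s ^ 15 + s ^ 15) + 2)
        (∑ r' ∈ Finset.range d, rename Fin.succ (q r') * X 0 ^ r' : MvPolynomial (Fin (n + 1)) F) := by
      have h := UABPComputes.sum (qmono hs (by norm_num) h2s : 2 ≤ s ^ 15)
        (fun r' : Fin d => (rename Fin.succ (q r') * X 0 ^ (r' : ℕ) : MvPolynomial (Fin (n + 1)) F))
        hqabp
      rwa [Fin.sum_univ_eq_sum_range (fun r' => rename Fin.succ (q r') * X 0 ^ r') d,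
        Fintype.card_fin] at h
    have hsum' : d * (s ^ 15 + s ^ 15) + 2 ≤ s ^ 18 :=
      qadd hs (qmul hd1 h1515) (qmono hs (by norm_num) h2s)
    have hRabp : UABPComputes (s ^ 15 + s ^ 15 + (d * (s ^ 15 + s ^ 15) + 2) + 2) R :=
      (((hWabp 0).mul (hWabp 1)).mul hsum).smul_C c⁻¹
    have hSR : s ^ 15 + s ^ 15 + (d * (s ^ 15 + s ^ 15) + 2) + 2 ≤ s ^ 20 :=
      qadd hs (qadd hs (qmono hs (by norm_num) h1515) hsum') (qmono hs (by norm_num) h2s)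
    -- (3) the trace-back with power budgets (`s := s ^ 20`)
    have hfin := uabpComputes_of_wronskian_congr_pow (s := s ^ 20) α (hTabp 1) (hTdeg 1) (hTα 1)
      hRabp hP (Nat.lt_succ_of_le hfd) (qmono hs (by norm_num) h2s) (qmono hs (by norm_num) hd1)
      (qmono hs (by norm_num) hd1) hSR (qmono hs (by norm_num) hST)
    rwa [← pow_mul] at hfin

/-- The `k = 2` de-bordering in the tree's layered-ABP vocabulary (`LayeredABPDegComputes`: the same
power budget bounds the number of vertices and the label degrees), as
`DDS2021_thm_3_2.layeredABPDegComputes` does for the named fact.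
[cite: DuttaDwivediSaxena2022, Thm. 3.2 (full version p0026 L710–717)] -/
theorem DDS2021_thm_3_2_two_layeredABPDegComputes : ∃ c : ℕ, ∀ (F : Type) [Field F] [CharZero F]
    (n d s : ℕ) (f : MvPolynomial (Fin n) F), d ≤ s → n ≤ s → 2 ≤ s →
      f ∈ border (spsClass (RatFunc F) n 2 d) → LayeredABPDegComputes (s ^ c) (s ^ c) f := by
  obtain ⟨c, hc⟩ := DDS2021_thm_3_2_two
  exact ⟨c, fun F _ _ n d s f hd hn hs hf => (hc F n d s f hd hn hs hf).layeredABPDegComputes⟩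

/-- The `k = 2` INSTANCE of the body of the named fact `DDS2021_thm_3_2` (budget `s ^ (c·k·7^k)` at
`k = 2`), the base case for a proof of Thm. 3.2 by induction on the top fan-in in that exact shape.
[cite: DuttaDwivediSaxena2022, Thm. 3.2 (full version p0026 L710–717)] -/
theorem DDS2021_thm_3_2_instance_two : ∃ c : ℕ, ∀ (F : Type) [Field F] [CharZero F]
    (n d s : ℕ) (f : MvPolynomial (Fin n) F), 1 ≤ 2 → 2 ≤ s → d ≤ s → n ≤ s → 2 ≤ s →
      f ∈ border (spsClass (RatFunc F) n 2 d) → UABPComputes (s ^ (c * 2 * 7 ^ 2)) f := by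
  obtain ⟨c, hc⟩ := DDS2021_thm_3_2_two
  refine ⟨c, fun F _ _ n d s f _ _ hd hn hs hf => (hc F n d s f hd hn hs hf).mono ?_⟩
  exact Nat.pow_le_pow_right (by omega) (by nlinarith)

end Main

end DDS2021

end Literature.Computability.AlgebraicComplexity

end
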